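import Summits.ResolutionOfSingularities.ResolutionOfSingularities.Theses.Descent
import Mathlib.RingTheory.LaurentSeries
import HarnessLib

/-!
# Artin–Greenberg transport on the base `𝕜⟦s⟧` — the LAURENT SLICE of rung B
(crux `Theses.Descent.DescentPerfectToAll`, stmt-ResolutionOfSingularities-0549; lens 4, gen 5;
OURS · CANDIDATE · counted 0; nothing here proves resolution in characteristic p)

Typed objects for the crux idea `artin-greenberg-laurent-slice`:
* `ResOver K`, `PerfectRes p` — resolution over one field / over all perfect fields of char `p`
  (the antecedent of the crux, verbatim binder shape);
* `LaurentSlice p` — `PerfectRes p →` resolution over every `𝕜⸨s⸩`, `𝕜` perfect of char `p`;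
  `laurentSlice_of_descentPerfectToAll` (PROVED): the slice is implied by the crux, i.e. it is a rung
  at or below B;
* `Model 𝕜` — flat proper `𝕜⟦s⟧`-schemes; `Model.trunc N` = base change to `𝕜⟦s⟧/(s^N)`;
  `TruncEquiv N M M'` — the two models agree modulo `s^N` (iso of truncations over the truncated base);
* `isRegular_iff_of_truncEquiv_two` — ORDER-2 DETERMINACY of regularity for flat proper models
  (theorem-grade; proof sketch in the docstring; `sorry` here);
* `ArithLaurentSlice p` — `PerfectRes p →` every integral flat proper `𝕜⟦s⟧`-model has a resolution;
  `laurentSlice_of_arith` (routine modulo Nagata/Chow; `sorry`);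
* `GreenbergStrongApproximation 𝕜` — Greenberg 1966 (Rond 2018 Thm 1.1) for `𝕜⟦s⟧`, typed as a
  named-fact-shaped `Prop` (not yet in `Literature/`).
The research content (format stabilisation / Greenberg-bound race) is in the card, not typed here.
-/

noncomputable section

set_option linter.dupNamespace false

open CategoryTheory AlgebraicGeometry
open Literature.AlgebraicGeometry.Resolution

namespace Summit.ResolutionOfSingularities.ResolutionOfSingularities.Cruxes.DescentPerfectToAll.ArtinGreenberg

/-- Resolution of every reduced separated finite-type scheme over the single field `K`
(the binder block of `ResolutionInChar`, one field at a time). -/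
def ResOver (K : Type) [Field K] : Prop :=
  ∀ (X : Scheme.{0}) (f : X ⟶ Spec (.of K)), IsSeparated f → LocallyOfFiniteType f →
    QuasiCompact f → IsReduced X → Scheme.HasResolution X

/-- `PerfectRes p`: the ANTECEDENT of the crux `DescentPerfectToAll` at the prime `p`. -/
def PerfectRes (p : ℕ) : Prop :=
  ∀ (k : Type) [Field k] [CharP k p] [PerfectField k], ResOver k

/-- The LAURENT SLICE of rung B at `p`: resolution over perfect fields gives resolution over every
Laurent series field `𝕜⸨s⸩` with `𝕜` perfect of characteristic `p` (the standing residual witness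
`𝔽_p⸨s⸩` of `descentPerfectToAll_iff_residual` is the case `𝕜 = 𝔽_p`). -/
def LaurentSlice (p : ℕ) : Prop :=
  PerfectRes p → ∀ (𝕜 : Type) [Field 𝕜] [CharP 𝕜 p] [PerfectField 𝕜], ResOver (LaurentSeries 𝕜)

/-- The slice is implied by the crux (so it is a rung at or below B, never above it). PROVED. -/
theorem laurentSlice_of_descentPerfectToAll (h : Theses.Descent.DescentPerfectToAll) (p : ℕ)
    (hp : p.Prime) : LaurentSlice p := by
  intro hPerf 𝕜 _ _ _ X f h1 h2 h3 h4
  haveI : CharP (LaurentSeries 𝕜) p := charP_of_injective_ringHom HahnSeries.C_injective p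
  have hRIC : Literature.AlgebraicGeometry.Resolution.ResolutionInChar.{0} p :=
    h p hp (fun k _ _ _ X f a b c d => hPerf k X f a b c d)
  exact hRIC (LaurentSeries 𝕜) X f h1 h2 h3 h4

/-- The ALGEBRAICALLY-CLOSED-RESIDUE sub-slice: resolution over `𝕜⸨s⸩` for `𝕜` algebraically closed of
char `p` (still a residual, imperfect, p-rank-1 ground field; this is the case in which the transport
of the card works with merely PROPER resolutions — strict henselianity of `𝕜⟦s⟧/(s^N)`). -/
def LaurentSliceAlgClosed (p : ℕ) : Prop :=
  PerfectRes p → ∀ (𝕜 : Type) [Field 𝕜] [CharP 𝕜 p] [IsAlgClosed 𝕜], ResOver (LaurentSeries 𝕜)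

/-- `LaurentSlice p → LaurentSliceAlgClosed p` (algebraically closed fields are perfect). PROVED. -/
theorem laurentSliceAlgClosed_of_laurentSlice (p : ℕ) (h : LaurentSlice p) :
    LaurentSliceAlgClosed p := by
  intro hPerf 𝕜 _ _ _
  haveI : PerfectField 𝕜 := inferInstance
  exact h hPerf 𝕜

section Models

variable (𝕜 : Type) [Field 𝕜]

/-- `Spec (𝕜⟦s⟧/(s^N))`. -/
def truncSpec (N : ℕ) : Scheme.{0} :=
  Spec (.of (PowerSeries 𝕜 ⧸ Ideal.span {(PowerSeries.X : PowerSeries 𝕜) ^ N}))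

/-- The closed immersion `Spec (𝕜⟦s⟧/(s^N)) ⟶ Spec 𝕜⟦s⟧`. -/
def truncHom (N : ℕ) : truncSpec 𝕜 N ⟶ Spec (.of (PowerSeries 𝕜)) :=
  Spec.map (CommRingCat.ofHom
    (Ideal.Quotient.mk (Ideal.span {(PowerSeries.X : PowerSeries 𝕜) ^ N})))

/-- A flat proper `𝕜⟦s⟧`-model. -/
structure Model where
  /-- total space -/
  X : Scheme.{0}
  /-- structure morphism to `Spec 𝕜⟦s⟧` -/
  f : X ⟶ Spec (.of (PowerSeries 𝕜))
  isProper : IsProper f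
  flat : Flat f

/-- Truncation `M ⊗_{𝕜⟦s⟧} 𝕜⟦s⟧/(s^N)`. -/
def Model.trunc (M : Model 𝕜) (N : ℕ) : Scheme.{0} :=
  Limits.pullback M.f (truncHom 𝕜 N)

/-- `M ≡ M' (mod s^N)`: the truncations are isomorphic OVER the truncated base. -/
def TruncEquiv (N : ℕ) (M M' : Model 𝕜) : Prop :=
  ∃ e : M.trunc 𝕜 N ≅ M'.trunc 𝕜 N,
    e.hom ≫ Limits.pullback.snd M'.f (truncHom 𝕜 N) = Limits.pullback.snd M.f (truncHom 𝕜 N)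

/-- ORDER-2 DETERMINACY OF REGULARITY (theorem-grade; OURS). If two flat proper `𝕜⟦s⟧`-models agree
modulo `s²` then one is regular iff the other is. Proof sketch: `M.X` is Noetherian and every point
specialises to a closed point, so regularity is tested at closed points; `M.f` proper ⇒ closed points
lie on the special fibre, so `s ∈ 𝔪_x`; flatness ⇒ `s` is a non-zero-divisor in `𝒪_{X,x}`, hence
`dim 𝒪_{X,x} = dim (𝒪_{X,x}/s) + 1`, while `𝔪_x/𝔪_x² = 𝔪̄/𝔪̄²` for `𝒪_{X,x}/s²` (`s² ∈ 𝔪_x²`); both data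
are read off `M.trunc 2 → truncSpec 2` (the special fibre is its reduction mod `s`), which `e`
identifies. No perfectness of `𝕜` is used. -/
theorem isRegular_iff_of_truncEquiv_two (M M' : Model 𝕜) (h : TruncEquiv 𝕜 2 M M') :
    Scheme.IsRegular M.X ↔ Scheme.IsRegular M'.X := by
  sorry

/-- The ARITHMETIC Laurent slice: resolution of integral flat proper `𝕜⟦s⟧`-models, `𝕜` perfect of
char `p`, from `PerfectRes p` (= `RegMod`-type statement of the record, for complete base with
perfect residue field). -/
def ArithLaurentSlice (p : ℕ) : Prop :=
  PerfectRes p → ∀ (𝕜 : Type) [Field 𝕜] [CharP 𝕜 p] [PerfectField 𝕜] (M : Model 𝕜),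
    IsIntegral M.X → Scheme.HasResolution M.X

end Models

/-- Arithmetic slice ⇒ Laurent slice (routine modulo Nagata compactification / Chow over `𝕜⸨s⸩` and
schematic closure over `𝕜⟦s⟧`: reduce to integral `X` fieldwise, compactify, take the flat proper
closure `M`, resolve `M`, restrict to the generic fibre, which is open in `M.X`). -/
theorem laurentSlice_of_arith (p : ℕ) : ArithLaurentSlice p → LaurentSlice p := by
  sorry

/-- GREENBERG'S STRONG APPROXIMATION for `𝕜⟦s⟧` (Greenberg 1966; Rond, *Artin Approximation*
(2018) Thm 1.1, any characteristic, `𝕜⟦s⟧` being a complete DVR): for every polynomial system over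
`𝕜⟦s⟧` there are `a b` with: a solution modulo `s^(a c + b)` is congruent modulo `s^c` to a true
solution. Typed as a named-fact-shaped `Prop` (candidate `Literature/` fact; not asserted). -/
def GreenbergStrongApproximation (𝕜 : Type) [Field 𝕜] : Prop :=
  ∀ (n m : ℕ) (F : Fin m → MvPolynomial (Fin n) (PowerSeries 𝕜)), ∃ a b : ℕ,
    ∀ (c : ℕ) (y : Fin n → PowerSeries 𝕜),
      (∀ i, MvPolynomial.eval y (F i) ∈ Ideal.span {(PowerSeries.X : PowerSeries 𝕜) ^ (a * c + b)}) →
      ∃ y' : Fin n → PowerSeries 𝕜, (∀ i, MvPolynomial.eval y' (F i) = 0) ∧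
        ∀ j, y' j - y j ∈ Ideal.span {(PowerSeries.X : PowerSeries 𝕜) ^ c}

end Summit.ResolutionOfSingularities.ResolutionOfSingularities.Cruxes.DescentPerfectToAll.ArtinGreenberg

end
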